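import Summits.CriticalPhenomena.CardyFormulaZ2.Theorems.CardyMeckeFlipZ2LimitsSymmetric
import Summits.CriticalPhenomena.CardyFormulaZ2.Theorems.CardyMeckeFlipLawToCrossingsQuads
import Summits.CriticalPhenomena.CardyFormulaZ2.Theorems.CardyAnchoredRigiditySubseqCardyJointLimitRotation
import Literature.Probability.Percolation.BoxArcStateReading
import Literature.Probability.Percolation.QuadCrossingContinuityEventsDischarge
import Literature.Probability.Percolation.QuadCrossingContinuityOfLemma51
import Literature.Probability.Percolation.QuadCrossingRawClosed
import Literature.Probability.Percolation.QuadCrossingNoiseDiscrete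

/-!
# Limit self-duality of the bond-`ℤ²` crossing probabilities of EVERY conformal rectangle
# (crux `SimilarityUpgrade`, stmt-CriticalPhenomena-4597, line `registered`, lead c4: sub-goal (A) `stub_dualSum`)

Route `CardyWhiteToColoured`, sub-problem `CardyFormulaZ2`.  For every conformal rectangle
`R = (Ω; a, b, c, d)` (ANY Jordan domain with four marked boundary points — no regularity of `∂Ω`),
with G02's discretisation (`bondDomainCrossingProb`: largest mesh component, distance-rule arcs),

  `P_{1/2}[(ab)_δ ↔ (cd)_δ] + P_{1/2}[(bc)_δ ↔ (da)_δ] → 1` as the mesh `δ → 0⁺`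

(`stub_dualSum`; this is verbatim the body of the crux `CardyOrderDuality.DualSum`, stmt-CriticalPhenomena-4716,
and the groundwork "G1, limit duality for all `R`" asked for by the c3 lead report of this crux).

Proof — an assembly of tree theorems, no new estimate.  Fix `R`; the second summand is the crossing
probability of the re-marked rectangle `R₃` (`MeckeFlipBridge.exists_shift3`: same carrier, arcs `0, 2` =
arcs `3, 1` of `R`; symmetry of the event in its two arcs, `discreteCrossing_comm`).  It suffices to
treat sequences of positive meshes `δₙ → 0` and to find a subsequence along which the sum tends to `1`
(`Filter.tendsto_of_subseq_tendsto`).  Let `Φ` be a square model of `R` (`exists_isSquareModel`), `Q` THE quad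
of `R` (`Quad.rectQuad (rotI.trans Φ) 1 1`: carrier `closure Ω`, sides `R.arc 0, 1, 2, 3`,
`MeckeFlipBridge.side_*_quadOf`) and `Qt` its transpose (`Quad.rectQuad Φ 1 1`: sides `R.arc 3, 0, 1, 2`).
Then (i) `|bond R δ - P[Q crossed at mesh δ]| → 0` and `|bond R₃ δ - P[Qt crossed]| → 0`
(`JointLimit.eventually_abs_bond_sub_quadCrossingProb_le`, `quadCrossing_eq_setOf_exists_isCrossing`);
(ii) along a subsequence the laws `μ_δ` on the compact metrisable Schramm–Smirnov space `ℋ_ℂ` converge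
weakly to some `μ ∈ Λ` (`isCompact_univ.tendsto_subseq`, `isSubseqQuadLimit_iff`); (iii) the crossing
events `⊞_Q`, `⊞_{Qt}` are `μ`-continuity sets (Schramm–Smirnov Lemma 5.1, `SchrammSmirnov2011_lemma_5_1_holds`),
so `P[Q crossed] → μ(⊞_Q)` and `P[Qt crossed] → μ(⊞_{Qt})` along it (portmanteau,
`ProbabilityMeasure.tendsto_measure_of_null_frontier_of_tendsto`); (iv) `μ(⊞_{Qt}) = 1 - μ(⊞_Q)` by the
exact self-duality of the one-quad marginals of every sublimit (`z2Limits_selfDualMarginals`, `n = 1`).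

References: O. Schramm, S. Smirnov, Ann. Probab. 39 (2011) §1.3–1.4, Lemma 5.1, Cor. 5.2;
G. Grimmett, *Percolation* (1999) §11.2; B. Bollobás, O. Riordan, *Percolation* (2006) Ch. 3 Lemma 1.
-/

noncomputable section

namespace Summit.CriticalPhenomena.CardyFormulaZ2.Cruxes.SimilarityUpgrade.Stubs

open Filter Topology Set MeasureTheory
open Literature.Probability.RandomPlanarGeometry
open Literature.Probability.Percolation
open Literature.Probability.Percolation.QuadCrossing
open Literature.Probability.LatticeModels (Site zdGraph)
open Summit.CriticalPhenomena.CardyFormulaZ2.Theorems (z2Limits_selfDualMarginals)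
open Summit.CriticalPhenomena.CardyFormulaZ2.Theorems.MeckeFlipBridge (exists_shift3 carrier_quadOf
  side_zero_quadOf side_one_quadOf side_two_quadOf side_three_quadOf carrier_transposeOf side_zero_transposeOf
  side_one_transposeOf side_two_transposeOf side_three_transposeOf)
open Summit.CriticalPhenomena.CardyFormulaZ2.Cruxes.SubseqCardy.Birth (JointLimit.eventually_abs_bond_sub_quadCrossingProb_le)

/-! ### The quad-crossing probability of a conformal rectangle read on the Schramm–Smirnov space -/

/-- For a quad `Q ∈ 𝒬_ℂ` with the carrier and the sides `0, 2` of the conformal rectangle `R`, the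
Schramm–Smirnov quad-crossing probability of `R` at mesh `δ > 0` is the `μ_δ`-measure of the crossing
event `⊞_Q` of `ℋ_ℂ`. [cite: SchrammSmirnov2011, §1.3] -/
theorem quadCrossingProb_eq_z2QuadLaw {R : ConformalRectangle} {Q : Quad (univ : Set ℂ)}
    (hc : Q.carrier = closure R.carrier) (h0 : Q.side 0 = R.arc 0) (h2 : Q.side 2 = R.arc 2)
    {δ : ℝ} (hδ : 0 < δ) :
    quadCrossingProb δ R =
      (((z2QuadLaw (univ : Set ℂ) δ : FiniteMeasure (QuadConfig (univ : Set ℂ))) :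
        Measure (QuadConfig (univ : Set ℂ))) (QuadConfig.crossedEvent Q)).toReal := by
  rw [quadCrossingProb, quadCrossing_eq_setOf_exists_isCrossing hc h0 h2 hδ,
    z2QuadLaw_apply isOpen_univ hδ (QuadConfig.isClosed_crossedEvent Q).measurableSet, measureReal_def]
  congr 2
  ext ω
  simp only [mem_setOf_eq, mem_preimage, QuadConfig.mem_crossedEvent]
  exact (mem_z2QuadConfig_iff_exists_isCrossing hδ).symm

/-! ### One-quad duality of every subsequential limit -/

/-- **`μ(⊞_{Qt}) + μ(⊞_Q) = 1` for every subsequential scaling limit `μ` and every quad `Q` with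
transpose `Qt`** (same carrier, `Q.side i = Qt.side (i + 1)`): the case `n = 1`, `A = {univ}` of the
exact self-duality of the finite-dimensional crossing marginals (`z2Limits_selfDualMarginals`), `μ`
being a probability measure. [cite: SchrammSmirnov2011, §1.3, Cor. 5.2] -/
theorem measure_crossedEvent_add_of_sides {μ : FiniteMeasure (QuadConfig (univ : Set ℂ))}
    (hμ : μ ∈ subseqQuadLimits (univ : Set ℂ)) {Q Qt : Quad (univ : Set ℂ)}
    (hcar : Q.carrier = Qt.carrier) (h0 : Q.side 0 = Qt.side 1) (h1 : Q.side 1 = Qt.side 2)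
    (h2 : Q.side 2 = Qt.side 3) (h3 : Q.side 3 = Qt.side 0) :
    (μ : Measure (QuadConfig (univ : Set ℂ))) (QuadConfig.crossedEvent Qt) +
      (μ : Measure (QuadConfig (univ : Set ℂ))) (QuadConfig.crossedEvent Q) = 1 := by
  haveI : IsProbabilityMeasure (μ : Measure (QuadConfig (univ : Set ℂ))) :=
    isProbabilityMeasure_of_isSubseqQuadLimit isOpen_univ hμ
  have key := z2Limits_selfDualMarginals μ hμ 1 (fun _ => Qt) (fun _ => Q)
    (fun _ => ⟨hcar, h0, h1, h2, h3⟩) {univ}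
  have hL : {S : QuadConfig (univ : Set ℂ) | {i : Fin 1 | Qt ∈ S} ∈ ({univ} : Set (Set (Fin 1)))} =
      QuadConfig.crossedEvent Qt := by
    ext S
    simp only [mem_setOf_eq, mem_singleton_iff, QuadConfig.mem_crossedEvent, eq_univ_iff_forall]
    exact ⟨fun h => h 0, fun h _ => h⟩
  have hR : {S : QuadConfig (univ : Set ℂ) | {i : Fin 1 | Q ∉ S} ∈ ({univ} : Set (Set (Fin 1)))} =
      (QuadConfig.crossedEvent Q)ᶜ := by
    ext S
    simp only [mem_setOf_eq, mem_singleton_iff, mem_compl_iff, QuadConfig.mem_crossedEvent,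
      eq_univ_iff_forall]
    exact ⟨fun h => h 0, fun h _ => h⟩
  rw [hL, hR, measure_compl (QuadConfig.isClosed_crossedEvent Q).measurableSet (measure_ne_top _ _),
    measure_univ] at key
  rw [key]
  exact tsub_add_cancel_of_le prob_le_one

/-! ### The sum along a sequence of positive meshes -/

/-- **Along every sequence of positive meshes `δₙ → 0` some subsequence has
`P[Q crossed] + P[Qt crossed] → 1`** (`Q`, `Qt` as above): compactness of the laws `μ_{δₙ}` on the
compact metrisable `ℋ_ℂ`, Schramm–Smirnov's Lemma 5.1 (null frontiers), the portmanteau theorem and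
the one-quad duality of the limit. [cite: SchrammSmirnov2011, Lemma 5.1, Cor. 5.2] -/
theorem exists_subseq_tendsto_quadSum {Q Qt : Quad (univ : Set ℂ)}
    (hcar : Q.carrier = Qt.carrier) (h0 : Q.side 0 = Qt.side 1) (h1 : Q.side 1 = Qt.side 2)
    (h2 : Q.side 2 = Qt.side 3) (h3 : Q.side 3 = Qt.side 0)
    {δ : ℕ → ℝ} (hpos : ∀ n, 0 < δ n) (hlim : Tendsto δ atTop (𝓝 0)) :
    ∃ φ : ℕ → ℕ, StrictMono φ ∧ Tendsto (fun k =>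
      ((((z2QuadLaw (univ : Set ℂ) (δ (φ k)) : FiniteMeasure (QuadConfig (univ : Set ℂ))) :
          Measure (QuadConfig (univ : Set ℂ))) (QuadConfig.crossedEvent Q)).toReal +
        (((z2QuadLaw (univ : Set ℂ) (δ (φ k)) : FiniteMeasure (QuadConfig (univ : Set ℂ))) :
          Measure (QuadConfig (univ : Set ℂ))) (QuadConfig.crossedEvent Qt)).toReal))
      atTop (𝓝 1) := by
  -- the laws as probability measures on the compact metrizable `ℋ_ℂ`, and a weak limit
  haveI : T2Space (QuadConfig (univ : Set ℂ)) :=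
    (SchrammSmirnov2011_thm_1_4_holds univ isOpen_univ univ_nonempty).1.2.2
  haveI : CompactSpace (QuadConfig (univ : Set ℂ)) := QuadConfig.compactSpace
  haveI : HasOuterApproxClosed (QuadConfig (univ : Set ℂ)) :=
    QuadConfig.hasOuterApproxClosed isOpen_univ univ_nonempty
  haveI : TopologicalSpace.MetrizableSpace (QuadConfig (univ : Set ℂ)) :=
    (SchrammSmirnov2011_thm_1_4_holds univ isOpen_univ univ_nonempty).1.2.1
  haveI : TopologicalSpace.SeparableSpace (QuadConfig (univ : Set ℂ)) := by
    letI := TopologicalSpace.metrizableSpaceMetric (QuadConfig (univ : Set ℂ))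
    infer_instance
  haveI hprob : ∀ n, IsProbabilityMeasure
      ((z2QuadLaw (univ : Set ℂ) (δ n) : FiniteMeasure (QuadConfig (univ : Set ℂ))) :
        Measure (QuadConfig (univ : Set ℂ))) :=
    fun n => isProbabilityMeasure_z2QuadLaw_of_pos isOpen_univ (hpos n)
  set π : ℕ → ProbabilityMeasure (QuadConfig (univ : Set ℂ)) := fun n =>
    ⟨((z2QuadLaw (univ : Set ℂ) (δ n) : FiniteMeasure (QuadConfig (univ : Set ℂ))) :
      Measure (QuadConfig (univ : Set ℂ))), hprob n⟩ with hπ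
  have hπF : ∀ n, (π n).toFiniteMeasure = z2QuadLaw (univ : Set ℂ) (δ n) := fun n => rfl
  obtain ⟨πlim, -, φ, hφ, hlimπ⟩ := isCompact_univ.tendsto_subseq (x := π) fun n => mem_univ _
  set μ : FiniteMeasure (QuadConfig (univ : Set ℂ)) := πlim.toFiniteMeasure with hμdef
  have hlimF : Tendsto (fun k => z2QuadLaw (univ : Set ℂ) (δ (φ k))) atTop (𝓝 μ) := by
    have := (ProbabilityMeasure.tendsto_nhds_iff_toFiniteMeasure_tendsto_nhds _).1 hlimπ
    simpa only [Function.comp_def, hπF] using this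
  -- `μ` is a subsequential scaling limit
  have hμ : μ ∈ subseqQuadLimits (univ : Set ℂ) :=
    (isSubseqQuadLimit_iff univ μ).2 ⟨fun k => δ (φ k), fun k => hpos _, hlim.comp hφ.tendsto_atTop, hlimF⟩
  -- null frontiers (Lemma 5.1) and the portmanteau theorem
  have hμm : (μ : Measure (QuadConfig (univ : Set ℂ))) = (πlim : Measure (QuadConfig (univ : Set ℂ))) := rfl
  have h51 := SchrammSmirnov2011_lemma_5_1_holds univ isOpen_univ univ_nonempty μ hμ
  have hfr : ∀ Q' : Quad (univ : Set ℂ), πlim (frontier (QuadConfig.crossedEvent Q')) = 0 := by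
    intro Q'
    have h := h51 Q'
    rw [hμm] at h
    exact (ProbabilityMeasure.null_iff_toMeasure_null πlim _).2 h
  have hQ : Tendsto (fun k => (π (φ k) : ProbabilityMeasure _) (QuadConfig.crossedEvent Q)) atTop
      (𝓝 (πlim (QuadConfig.crossedEvent Q))) :=
    ProbabilityMeasure.tendsto_measure_of_null_frontier_of_tendsto hlimπ (hfr Q)
  have hQt : Tendsto (fun k => (π (φ k) : ProbabilityMeasure _) (QuadConfig.crossedEvent Qt)) atTop
      (𝓝 (πlim (QuadConfig.crossedEvent Qt))) :=
    ProbabilityMeasure.tendsto_measure_of_null_frontier_of_tendsto hlimπ (hfr Qt)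
  -- one-quad duality of the limit
  have hsum : (πlim (QuadConfig.crossedEvent Q) : ℝ) + (πlim (QuadConfig.crossedEvent Qt) : ℝ) = 1 := by
    have key := measure_crossedEvent_add_of_sides hμ hcar h0 h1 h2 h3
    rw [hμm, ← ProbabilityMeasure.ennreal_coeFn_eq_coeFn_toMeasure πlim (QuadConfig.crossedEvent Qt),
      ← ProbabilityMeasure.ennreal_coeFn_eq_coeFn_toMeasure πlim (QuadConfig.crossedEvent Q),
      ← ENNReal.coe_add, ENNReal.coe_eq_one] at key
    have hkey := congrArg (fun t : NNReal => (t : ℝ)) key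
    simp only [NNReal.coe_add, NNReal.coe_one] at hkey
    linarith
  -- conclusion
  refine ⟨φ, hφ, ?_⟩
  have hreal : ∀ k (E : Set (QuadConfig (univ : Set ℂ))),
      ((((z2QuadLaw (univ : Set ℂ) (δ (φ k)) : FiniteMeasure (QuadConfig (univ : Set ℂ))) :
          Measure (QuadConfig (univ : Set ℂ))) E).toReal) = ((π (φ k) : ProbabilityMeasure _) E : ℝ) := by
    intro k E
    rw [← hπF]
    rfl
  simp_rw [hreal]
  rw [← hsum]
  exact ((NNReal.continuous_coe.tendsto _).comp hQ).add ((NNReal.continuous_coe.tendsto _).comp hQt)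

/-! ### The stub -/

/-- **`stub_dualSum` — limit self-duality of G02's discretisation for EVERY conformal rectangle**:
`bondDomainCrossingProb R δ + discreteCrossingProb half R.carrier δ (R.arc 1) (R.arc 3) → 1` as
`δ → 0⁺` (verbatim the body of `CardyOrderDuality.DualSum`, stmt-CriticalPhenomena-4716).  Assembly:
the second summand is `bondDomainCrossingProb R₃ δ` for the re-marked rectangle `R₃`
(`exists_shift3`, `discreteCrossing_comm`); both summands are within `o(1)` of the
Schramm–Smirnov quad-crossing probabilities of THE quad `Q` of `R` and of its transpose `Qt`
(`JointLimit.eventually_abs_bond_sub_quadCrossingProb_le`, `quadCrossingProb_eq_z2QuadLaw`); along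
sequences, `exists_subseq_tendsto_quadSum`. [cite: SchrammSmirnov2011, Lemma 5.1, Cor. 5.2] -/
theorem stub_dualSum :
    ∀ R : ConformalRectangle, Tendsto (fun δ : ℝ => bondDomainCrossingProb R δ +
      discreteCrossingProb half R.carrier δ (R.arc 1) (R.arc 3)) (𝓝[>] (0 : ℝ)) (𝓝 1) := by
  intro R
  -- the re-marked rectangle and the two quads
  obtain ⟨R₃, hc₃, -, h0₃, -, h2₃, -⟩ := exists_shift3 R
  have hsnd : ∀ δ, discreteCrossingProb half R.carrier δ (R.arc 1) (R.arc 3) =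
      bondDomainCrossingProb R₃ δ := by
    intro δ
    rw [bondDomainCrossingProb, hc₃, h0₃, h2₃, discreteCrossingProb, discreteCrossingProb, discreteCrossing_comm]
  simp_rw [hsnd]
  obtain ⟨Φ, hΦ⟩ := exists_isSquareModel R
  set Q : Quad (univ : Set ℂ) := Quad.rectQuad ((Homeomorph.mulLeft₀ Complex.I Complex.I_ne_zero).trans Φ)
    1 1 one_pos one_pos (fun _ => mem_univ _) with hQdef
  set Qt : Quad (univ : Set ℂ) := Quad.rectQuad Φ 1 1 one_pos one_pos (fun _ => mem_univ _) with hQtdef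
  have hQc : Q.carrier = closure R.carrier := carrier_quadOf hΦ
  have hQ0 : Q.side 0 = R.arc 0 := side_zero_quadOf hΦ
  have hQ1 : Q.side 1 = R.arc 1 := side_one_quadOf hΦ
  have hQ2 : Q.side 2 = R.arc 2 := side_two_quadOf hΦ
  have hQ3 : Q.side 3 = R.arc 3 := side_three_quadOf hΦ
  have hQtc : Qt.carrier = closure R.carrier := carrier_transposeOf hΦ
  have hQt0 : Qt.side 0 = R.arc 3 := side_zero_transposeOf hΦ
  have hQt1 : Qt.side 1 = R.arc 0 := side_one_transposeOf hΦ
  have hQt2 : Qt.side 2 = R.arc 1 := side_two_transposeOf hΦ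
  have hQt3 : Qt.side 3 = R.arc 2 := side_three_transposeOf hΦ
  -- sequences of meshes suffice
  refine tendsto_of_subseq_tendsto fun ns hns => ?_
  have hpos_ev : ∀ᶠ n in atTop, 0 < ns n := hns.eventually (self_mem_nhdsWithin)
  obtain ⟨N, hN⟩ := eventually_atTop.1 hpos_ev
  have hns0 : Tendsto ns atTop (𝓝 0) := tendsto_nhds_of_tendsto_nhdsWithin hns
  -- the shifted (positive) sequence
  set δ : ℕ → ℝ := fun n => ns (n + N) with hδdef
  have hδpos : ∀ n, 0 < δ n := fun n => hN _ (Nat.le_add_left N n)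
  have hδlim : Tendsto δ atTop (𝓝 0) := hns0.comp (tendsto_add_atTop_nat N)
  have hδlim' : Tendsto δ atTop (𝓝[>] (0 : ℝ)) :=
    tendsto_nhdsWithin_iff.2 ⟨hδlim, Eventually.of_forall hδpos⟩
  obtain ⟨φ, hφ, hquad⟩ := exists_subseq_tendsto_quadSum (Q := Q) (Qt := Qt)
    (by rw [hQc, hQtc]) (by rw [hQ0, hQt1]) (by rw [hQ1, hQt2]) (by rw [hQ2, hQt3]) (by rw [hQ3, hQt0])
    hδpos hδlim
  refine ⟨fun k => φ k + N, ?_⟩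
  -- bond ≈ quad along the subsequence, for `R` and `R₃`
  have hδφ : Tendsto (fun k => δ (φ k)) atTop (𝓝[>] (0 : ℝ)) := hδlim'.comp hφ.tendsto_atTop
  have happrox : Tendsto (fun k => (bondDomainCrossingProb R (δ (φ k)) - quadCrossingProb (δ (φ k)) R) +
      (bondDomainCrossingProb R₃ (δ (φ k)) - quadCrossingProb (δ (φ k)) R₃)) atTop (𝓝 0) := by
    rw [← add_zero (0 : ℝ)]
    refine Tendsto.add ?_ ?_
    · rw [Metric.tendsto_nhds]
      intro ε hε
      filter_upwards [hδφ.eventually (JointLimit.eventually_abs_bond_sub_quadCrossingProb_le R (half_pos hε))]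
        with k hk
      rw [Real.dist_0_eq_abs]
      linarith
    · rw [Metric.tendsto_nhds]
      intro ε hε
      filter_upwards [hδφ.eventually (JointLimit.eventually_abs_bond_sub_quadCrossingProb_le R₃ (half_pos hε))]
        with k hk
      rw [Real.dist_0_eq_abs]
      linarith
  -- the quad-crossing probabilities read on `ℋ_ℂ`
  have hqQ : ∀ k, quadCrossingProb (δ (φ k)) R =
      ((((z2QuadLaw (univ : Set ℂ) (δ (φ k)) : FiniteMeasure (QuadConfig (univ : Set ℂ))) :
          Measure (QuadConfig (univ : Set ℂ))) (QuadConfig.crossedEvent Q)).toReal) :=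
    fun k => quadCrossingProb_eq_z2QuadLaw hQc hQ0 hQ2 (hδpos _)
  have hqQt : ∀ k, quadCrossingProb (δ (φ k)) R₃ =
      ((((z2QuadLaw (univ : Set ℂ) (δ (φ k)) : FiniteMeasure (QuadConfig (univ : Set ℂ))) :
          Measure (QuadConfig (univ : Set ℂ))) (QuadConfig.crossedEvent Qt)).toReal) :=
    fun k => quadCrossingProb_eq_z2QuadLaw (by rw [hQtc, hc₃]) (by rw [hQt0, h0₃]) (by rw [hQt2, h2₃]) (hδpos _)
  have hquad' : Tendsto (fun k => quadCrossingProb (δ (φ k)) R + quadCrossingProb (δ (φ k)) R₃) atTop (𝓝 1) := by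
    simp_rw [hqQ, hqQt]
    exact hquad
  have := happrox.add hquad'
  rw [zero_add] at this
  refine this.congr fun k => ?_
  show _ = bondDomainCrossingProb R (ns (φ k + N)) + bondDomainCrossingProb R₃ (ns (φ k + N))
  simp only [hδdef]
  ring
end Summit.CriticalPhenomena.CardyFormulaZ2.Cruxes.SimilarityUpgrade.Stubs

end
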